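import Summits.MatrixMultiplication.MatrixMultiplication.Theorems.SoloInformedPairCount

/-!
# LEMMA Z, counted: same-shadow pairs are few

This work, §8.7 (m) / `paircount-m2.md` §2. Generic core: if every fibre of a map `φ : X → S` has at most
`r` points then the ordered pairs `x ≠ x'` with `φ x = φ x'` number at most `(r - 1)|X|`
(`card_offDiag_pairs_add_card_le`). Twisted-TPP instance (`k`-direction of LEMMA Z): if the pairs of
distinct cells with equal shadow `a⁰` are separated in the `k`-plane (which is what closedness of the cell
triple with `k = k'` means for a flat chart), then by the plane bound `kPlane_card` every shadow fibre has at
most `r = (|S¹|+1)/2` cells, so `2·#{same-shadow ordered pairs of distinct cells} ≤ (|S¹| - 1)·n²`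
(`kShadow_pairs_le`); summing over `k` gives `Z_k ≤ (r-1)n³`. The `j`-direction is symmetric
(`jShadow_pairs_le`). References: this work §8.7 (l)–(m); CohnUmans2013 (arXiv:1207.6528) Def. 12.
-/

namespace Summit.MatrixMultiplication.MatrixMultiplication.Theorems.TwistedTPP.FibreLines

open Finset

/-- If every fibre of `φ` has at most `r` points, then
`#{(x,x') : x ≠ x', φ x = φ x'} + |X| ≤ r·|X|`. [this work, §8.7 (m)] -/
theorem card_offDiag_pairs_add_card_le {X S : Type*} [Fintype X] [DecidableEq X] [DecidableEq S]
    (φ : X → S) (r : ℕ) (hfib : ∀ s, ((univ : Finset X).filter (fun x => φ x = s)).card ≤ r) :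
    ((univ : Finset (X × X)).filter (fun p => p.1 ≠ p.2 ∧ φ p.1 = φ p.2)).card + Fintype.card X
      ≤ r * Fintype.card X := by
  -- all equal-value pairs = off-diagonal ones + the diagonal
  have hsplit : ((univ : Finset (X × X)).filter (fun p => φ p.1 = φ p.2)).card
      = ((univ : Finset (X × X)).filter (fun p => p.1 ≠ p.2 ∧ φ p.1 = φ p.2)).card
        + ((univ : Finset (X × X)).filter (fun p => p.1 = p.2)).card := by
    rw [← card_union_of_disjoint]
    · congr 1
      ext p
      simp only [mem_filter, mem_univ, true_and, mem_union]
      constructor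
      · intro h
        by_cases hp : p.1 = p.2
        · exact Or.inr hp
        · exact Or.inl ⟨hp, h⟩
      · rintro (⟨_, h⟩ | h)
        · exact h
        · rw [h]
    · rw [disjoint_left]
      intro p hp hp'
      simp only [mem_filter, mem_univ, true_and] at hp hp'
      exact hp.1 hp'
  have hdiag : ((univ : Finset (X × X)).filter (fun p => p.1 = p.2)).card = Fintype.card X := by
    rw [← Finset.card_univ, ← card_image_of_injective univ (f := fun x : X => (x, x))
      (fun x y hxy => (Prod.mk.inj hxy).1)]
    congr 1
    ext p
    simp only [mem_filter, mem_univ, true_and, mem_image]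
    constructor
    · intro h
      exact ⟨p.1, by rw [Prod.ext_iff]; exact ⟨rfl, h⟩⟩
    · rintro ⟨x, rfl⟩
      rfl
  rw [← hdiag, ← hsplit, card_pairs_eq_sum_sq, hdiag, ← card_univ,
    card_eq_sum_card_image φ univ, mul_sum]
  refine sum_le_sum fun s _ => ?_
  rw [sq]
  exact Nat.mul_le_mul_right _ (hfib s)

variable {ι G : Type*} [AddCommGroup G]

/-- **LEMMA Z, `k`-direction, counted.** If distinct cells with equal shadow `a⁰` are pairwise separated in
the `k`-plane, then `2·(#{(x,x') : x ≠ x', a⁰ x = a⁰ x'} + n²) ≤ (|S¹| + 1)·n²`, i.e. the same-shadow ordered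
pairs of distinct cells number at most `(r-1)n²` with `r = (|S¹|+1)/2`. [this work, §8.7 (m)] -/
theorem kShadow_pairs_le [Fintype ι] [DecidableEq ι] [Fintype G] [DecidableEq G] {S : Type*}
    [DecidableEq S] (hG : ∀ x : G, x = -x → x = 0) (D : Data ι G) (a0 : ι × ι → S) (k : ι)
    (H : ∀ p p' : ι × ι, p ≠ p' → a0 p = a0 p' → D.Sep p.1 p.2 k p'.1 p'.2 k) :
    2 * (((univ : Finset ((ι × ι) × (ι × ι))).filter
        (fun pp => pp.1 ≠ pp.2 ∧ a0 pp.1 = a0 pp.2)).card + Fintype.card (ι × ι))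
      ≤ (Fintype.card G + 1) * Fintype.card (ι × ι) := by
  have hfib : ∀ s, 2 * ((univ : Finset (ι × ι)).filter (fun x => a0 x = s)).card
      ≤ Fintype.card G + 1 := by
    intro s
    refine kPlane_card hG D k _ (fun p hp p' hp' hpp => H p p' hpp ?_)
    simp only [mem_filter, mem_univ, true_and] at hp hp'
    rw [hp, hp']
  have hr : ∀ s, ((univ : Finset (ι × ι)).filter (fun x => a0 x = s)).card
      ≤ (Fintype.card G + 1) / 2 :=
    fun s => (Nat.le_div_iff_mul_le two_pos).2 (by rw [mul_comm]; exact hfib s)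
  have hgen := card_offDiag_pairs_add_card_le a0 ((Fintype.card G + 1) / 2) hr
  calc 2 * (((univ : Finset ((ι × ι) × (ι × ι))).filter
          (fun pp => pp.1 ≠ pp.2 ∧ a0 pp.1 = a0 pp.2)).card + Fintype.card (ι × ι))
      ≤ 2 * ((Fintype.card G + 1) / 2 * Fintype.card (ι × ι)) := Nat.mul_le_mul_left 2 hgen
    _ = (2 * ((Fintype.card G + 1) / 2)) * Fintype.card (ι × ι) := by ring
    _ ≤ (Fintype.card G + 1) * Fintype.card (ι × ι) :=
        Nat.mul_le_mul_right _ (Nat.mul_div_le (Fintype.card G + 1) 2)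

/-- **LEMMA Z, `j`-direction, counted.** If distinct cells `(i,k)` with equal shadow `c⁰` are pairwise
separated in the `j`-plane, then `2·(#{(x,x') : x ≠ x', c⁰ x = c⁰ x'} + n²) ≤ (|S¹| + 1)·n²`, i.e. the same-shadow ordered
pairs of distinct cells number at most `(r-1)n²` with `r = (|S¹|+1)/2`. [this work, §8.7 (m)] -/
theorem jShadow_pairs_le [Fintype ι] [DecidableEq ι] [Fintype G] [DecidableEq G] {S : Type*}
    [DecidableEq S] (hG : ∀ x : G, x = -x → x = 0) (D : Data ι G) (c0 : ι × ι → S) (j : ι)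
    (H : ∀ p p' : ι × ι, p ≠ p' → c0 p = c0 p' → D.Sep p.1 j p.2 p'.1 j p'.2) :
    2 * (((univ : Finset ((ι × ι) × (ι × ι))).filter
        (fun pp => pp.1 ≠ pp.2 ∧ c0 pp.1 = c0 pp.2)).card + Fintype.card (ι × ι))
      ≤ (Fintype.card G + 1) * Fintype.card (ι × ι) := by
  have hfib : ∀ s, 2 * ((univ : Finset (ι × ι)).filter (fun x => c0 x = s)).card
      ≤ Fintype.card G + 1 := by
    intro s
    refine jPlane_card hG D j _ (fun p hp p' hp' hpp => H p p' hpp ?_)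
    simp only [mem_filter, mem_univ, true_and] at hp hp'
    rw [hp, hp']
  have hr : ∀ s, ((univ : Finset (ι × ι)).filter (fun x => c0 x = s)).card
      ≤ (Fintype.card G + 1) / 2 :=
    fun s => (Nat.le_div_iff_mul_le two_pos).2 (by rw [mul_comm]; exact hfib s)
  have hgen := card_offDiag_pairs_add_card_le c0 ((Fintype.card G + 1) / 2) hr
  calc 2 * (((univ : Finset ((ι × ι) × (ι × ι))).filter
          (fun pp => pp.1 ≠ pp.2 ∧ c0 pp.1 = c0 pp.2)).card + Fintype.card (ι × ι))
      ≤ 2 * ((Fintype.card G + 1) / 2 * Fintype.card (ι × ι)) := Nat.mul_le_mul_left 2 hgen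
    _ = (2 * ((Fintype.card G + 1) / 2)) * Fintype.card (ι × ι) := by ring
    _ ≤ (Fintype.card G + 1) * Fintype.card (ι × ι) :=
        Nat.mul_le_mul_right _ (Nat.mul_div_le (Fintype.card G + 1) 2)

end Summit.MatrixMultiplication.MatrixMultiplication.Theorems.TwistedTPP.FibreLines
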